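/-
Copyright (c) 2026. Released under Apache 2.0 license.
-/
import Literature.NumberTheory.ComplexMultiplication.ShimuraReciprocityExtendedRingClass
import Literature.NumberTheory.NumberFields.IdelicArtinMapOnCongruenceIdeles
import Literature.NumberTheory.EllipticCurves.XZeroThirtyTwoEtaQuotientSqrtXProofs
import HarnessLib

/-!
# Shimura reciprocity for the ray class field — PROOFS companion: the ideal-theoretic reading
# `((K^{(m)}|K)/(β)) (f(τ₀)) = f^{ḡ_{τ₀}(β)}(τ₀)` and the instance `s = η(16τ)³/(η(8τ)η(32τ)²) ∈ 𝖥_{32,ℚ}`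

Topic `Literature/NumberTheory/ComplexMultiplication`; namespace
`Literature.NumberTheory.ComplexMultiplication.Cox2013` (proof companion of
`ShimuraReciprocityExtendedRingClass`, the display of Cox 2013 Thms. 15.16–15.17). Cell `bsd-print-cf2`, typer
seat `-ty2` (g51), part of deliverable (A3) (+ the bridge of (A1)) of the pen's SUMMON 2026-08-31T03:11:49Z for
crux `stmt-BirchSwinnertonDyer-20509`. THEOREMS ONLY, all proved (no definition, no named fact, no instance):

* `gBar_apply`, `det_gBar` — the entries of Cox's `ḡ_{τ₀}(u) = (A − bB, −Bc; aB, A)` and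
  `det = A² − bAB + acB² = N(A + B·aτ₀)` (p. 348 «`det(ḡ_{τ₀}(u)) = [N(β)]`»).
* `abRestrict_ideleArtinMap_rayClassField_eq_artinHom` — THE DICTIONARY behind the display's choice of
  currency: for a unit idèle `x` and `β ∈ Kˣ` with `(β)·x ≡ 1 (mod 𝔪)` (`principalIdele K β * x ∈ I_K^{(𝔪)}`),
  `[x, K]|_{K^𝔪} = ((K^𝔪|K)/(β))`, the tree's Artin symbol `artinHom (galFrob K K^𝔪)` of the principal ideal
  `(β)` — the tree's `map_abRestrict_ideleArtinMap_of_mem_unitIdeles` (Shimura 1971 §5.2) at `χ = id`,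
  `L = K^𝔪` (`K` totally complex). So the unit idèle congruent to `u` is the Artin symbol of the IDEAL
  `(u)⁻¹`: Cox's idelic `σ_u` (proof of Thm. 15.17, p. 358) is `((K^{(m)}|K)/(β))` with `β ≡ u⁻¹`.
* `exists_unitIdele_mul_mem_congruenceIdeles` — for `(β)` prime to `𝔪` such an `x` exists
  (`x = idealIdele (β) · (β)⁻¹`).
* **`artinSymbol_apply_eq_of_fact`** — granted the display fact `cox2013_shimuraReciprocity_rayClassField`,
  its IDEAL-theoretic reading: for `β ∈ 𝓞 K` with `(β)` prime to `m` and `ι β = A + B·aτ₀`,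
  `e(((K^{(m)}|K)/(β)) y) = f(γ·τ₀)` for `e y = f(τ₀)` and every `γ ∈ SL(2,ℤ)` with
  `γ ≡ (1 0; 0 N(β)⁻¹)·(A − bB, −cB; aB, A) (mod m)` — i.e. `((K^{(m)}|K)/(β))(f(τ₀)) = f^{ḡ_{τ₀}(β)}(τ₀)`
  (NO inverse on `β` in the ideal-theoretic labelling; Cox's printed `ḡ_{τ₀}(u⁻¹)` refers to the idelic `u`).
* **`isRationalModularFunctionOfLevel_etaQuotient_rS`** — the LEAD's instance: `s = η(16τ)³/(η(8τ)η(32τ)²)`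
  (`etaQuotient 32 rS`) satisfies the display predicate `IsRationalModularFunctionOfLevel 32` (holomorphic,
  `Γ(32)`-invariant by Newman's theorem with character `(2/·)`, `q·s(γτ)` bounded at `i∞` for every
  `γ ∈ SL(2,ℤ)`, rational — indeed integral — expansion `𝕢₃₂³²·s = q·s = Σ_k P_k q^k`, `P ∈ 1 + qℤ⟦q⟧`);
  hence `artinSymbol_etaQuotient_rS_of_fact`: the reciprocity law for `s` at a level-`32` CM point of `𝒪_K`,
  modulo the fact.

## References

* [Cox2013] D. A. Cox, *Primes of the form x² + ny²*, 2nd ed., Wiley 2013, §15.C p. 347–348 (Thms. 15.16,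
  15.17, the matrix `ḡ_{τ₀}`), §15.E p. 358–359 (proofs).
* [Shimura1971] G. Shimura, *Introduction to the arithmetic theory of automorphic functions*, 1971, §5.2
  p. 116 («`[u, K]` coincides with the Artin symbol `(F_𝔠/K / il(u))`»), Thm. 6.31 (i) p. 158.
* [NeukirchANT1999] J. Neukirch, *Algebraic Number Theory*, Springer 1999, Ch. VI §1 Prop. (1.9) p. 365.
-/

noncomputable section

open UpperHalfPlane hiding I
open NumberField IsDedekindDomain Complex Filter
open scoped MatrixGroups Manifold Topology nonZeroDivisors

namespace Literature.NumberTheory.ComplexMultiplication.Cox2013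

open Literature.NumberTheory.NumberFields Literature.NumberTheory.GaloisRepresentations
open Literature.NumberTheory.EllipticCurves (heegnerTau)
open Literature.NumberTheory.EllipticCurves.ModularForms

/-! ## The matrix `ḡ_{τ₀}(u)` -/

/-- The entries of `ḡ_{τ₀}(u) = (A − bB, −Bc; aB, A)`. [cite: Cox2013, §15.C p. 348] -/
theorem gBar_apply (a b c A B : ℤ) :
    gBar a b c A B 0 0 = A - b * B ∧ gBar a b c A B 0 1 = -(c * B) ∧
      gBar a b c A B 1 0 = a * B ∧ gBar a b c A B 1 1 = A :=
  ⟨rfl, rfl, rfl, rfl⟩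

/-- **`det ḡ_{τ₀}(u) = N(u)`**: `det (A − bB, −Bc; aB, A) = A² − bAB + acB²`, the norm of `A + B·aτ₀`
(`aτ₀ + aτ̄₀ = −b`, `aτ₀·aτ̄₀ = ac`). [cite: Cox2013, §15.C p. 348 («det(ḡ_{τ₀}(u)) = [N(β)]»)] -/
theorem det_gBar (a b c A B : ℤ) : (gBar a b c A B).det = A ^ 2 - b * A * B + a * c * B ^ 2 := by
  rw [gBar, Matrix.det_fin_two_of]
  ring

/-! ## The dictionary: a unit idèle `x ≡ β⁻¹ (mod 𝔪)` acts on `K^𝔪` as the Artin symbol of `(β)` -/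

section Dictionary

variable {K : Type} [Field K] [NumberField K] [IsTotallyComplex K] {𝔪 : Ideal (𝓞 K)}

/-- **`[x, K]|_{K^𝔪} = ((K^𝔪|K)/(β))` for a unit idèle `x` with `(β)·x ∈ I_K^{(𝔪)}`** (`K` totally complex,
`K^𝔪 = rayClassField K 𝔪`): the unit idèle congruent to `u = β⁻¹` modulo `𝔪` is, on the ray class field,
the Artin symbol of the principal ideal `(β) = (u)⁻¹` — the tree's
`map_abRestrict_ideleArtinMap_of_mem_unitIdeles` (Shimura §5.2) read on `K^𝔪` itself.
[cite: Shimura1971, §5.2 p. 116] [cite: NeukirchANT1999, Ch. VI §1 Prop. (1.9) (proof) p. 365] -/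
theorem abRestrict_ideleArtinMap_rayClassField_eq_artinHom (h𝔪 : 𝔪 ≠ ⊥) {x : ideleGroup K}
    (hx : x ∈ unitIdeles K) {β : Kˣ} (hβx : principalIdele K β * x ∈ congruenceIdeles 𝔪) :
    abRestrict (rayClassField K 𝔪) (ideleArtinMap K x) =
      artinHom (galFrob K (rayClassField K 𝔪)) (toPrincipalIdeal (𝓞 K) K β) := by
  have hL : principalIdeles K ⊔ congruenceUnitIdeles 𝔪 ≤ Automorphic.normGroup K (rayClassField K 𝔪) := by
    rw [normGroup_rayClassField, principalIdeles_sup_rayUnitIdeles_eq h𝔪]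
  have h := map_abRestrict_ideleArtinMap_of_mem_unitIdeles h𝔪 hL
    (MonoidHom.id ((rayClassField K 𝔪) ≃ₐ[K] (rayClassField K 𝔪))) hx hβx
  simpa only [MonoidHom.id_apply] using h

omit [IsTotallyComplex K] in
/-- **For `(β)` prime to `𝔪` there is a unit idèle `x` with `(β)·x ∈ I_K^{(𝔪)}`**, namely
`x = idealIdele (β) · (β)⁻¹` (its ideal is `(β)(β)⁻¹ = 1`, and `(β)·x = idealIdele (β) ∈ I_K^{(𝔪)}`).
[cite: NeukirchANT1999, Ch. VI §1 Prop. (1.9) (proof) p. 365] -/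
theorem exists_unitIdele_mul_mem_congruenceIdeles (h𝔪 : 𝔪 ≠ ⊥) (β : Kˣ)
    (hβ : toPrincipalIdeal (𝓞 K) K β ∈ idealsPrimeTo 𝔪) :
    ∃ x ∈ unitIdeles K, principalIdele K β * x ∈ congruenceIdeles 𝔪 := by
  refine ⟨idealIdele (toPrincipalIdeal (𝓞 K) K β) * (principalIdele K β)⁻¹, ?_, ?_⟩
  · rw [← ideleIdeal_eq_one_iff_mem_unitIdeles, ← ideleIdealHom_apply, map_mul, map_inv,
      ideleIdealHom_apply, ideleIdealHom_apply, ideleIdeal_idealIdele, ideleIdeal_principalIdele,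
      mul_inv_cancel]
  · rw [mul_inv_cancel_comm_assoc] -- `β * (I * β⁻¹) = I`
    exact idealIdele_mem_congruenceIdeles h𝔪 hβ

end Dictionary

/-! ## The ideal-theoretic reading of the display fact -/

/-- `(m) ≠ 0` in `𝓞 K` for `m ≥ 1`. [folklore] -/
private theorem span_natCast_ne_bot {K : Type} [Field K] [NumberField K] {m : ℕ} (hm : 0 < m) :
    (Ideal.span {(m : 𝓞 K)} : Ideal (𝓞 K)) ≠ ⊥ := by
  rw [Ne, Ideal.span_singleton_eq_bot]
  exact_mod_cast hm.ne'

/-- **Cox's Thm. 15.17 in IDEAL-theoretic currency** (granted the display fact): with the notation of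
`cox2013_shimuraReciprocity_rayClassField`, for `β ∈ 𝓞 K` with `(β)` prime to `m`, `ι β = A + B·aτ₀`, and
`n′N(β) ≡ 1 (mod m)`: the ARTIN SYMBOL `((K^{(m)}|K)/(β))` (the tree's `artinHom (galFrob K K^{(m)})` at the
principal ideal `(β)`, = Cox's `σ_u` for the idelic `u ≡ β⁻¹`) satisfies
`e(((K^{(m)}|K)/(β)) y) = f(γ·τ₀)` whenever `e y = f(τ₀)` and `γ ∈ SL(2,ℤ)` reduces to
`(1 0; 0 n′)·(A − bB, −cB; aB, A)` modulo `m` — i.e. `((K^{(m)}|K)/(β))(f(τ₀)) = f^{ḡ_{τ₀}(β)}(τ₀)`.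
[cite: Cox2013, Thm. 15.17 (p. 348), proof p. 358–359] [cite: Shimura1971, §5.2 p. 116; Thm. 6.31 (i) p. 158] -/
theorem artinSymbol_apply_eq_of_fact (h : cox2013_shimuraReciprocity_rayClassField)
    (K : Type) [Field K] [NumberField K] (ι : K →+* ℂ)
    (hK : Literature.NumberTheory.EllipticCurves.IsImaginaryQuadratic K) (m : ℕ) (hm : 0 < m)
    (f : ℍ → ℂ) (hf : IsRationalModularFunctionOfLevel m f)
    (a b c : ℤ) (ha : 0 < a) (hD : b ^ 2 - 4 * a * c < 0) (hprim : Int.gcd (Int.gcd a b) c = 1)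
    (θ : 𝓞 K) (hθ : ι (θ : K) = (a : ℂ) * ((heegnerTau (a, b, c) : ℍ) : ℂ))
    (hgen : ∀ z : 𝓞 K, ∃ A B : ℤ, (z : K) = A + B * (θ : K))
    (e : rayClassField K (Ideal.span {(m : 𝓞 K)}) →+* ℂ)
    (he : ∀ k : K, e (algebraMap K (rayClassField K (Ideal.span {(m : 𝓞 K)})) k) = ι k)
    (β : 𝓞 K) (hβ : (β : K) ≠ 0)
    (hβm : toPrincipalIdeal (𝓞 K) K (Units.mk0 (β : K) hβ) ∈ idealsPrimeTo (Ideal.span {(m : 𝓞 K)}))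
    (A B : ℤ) (hAB : (β : K) = A + B * (θ : K))
    (n' : ℤ) (hn' : ((n' * (A ^ 2 - b * A * B + a * c * B ^ 2) : ℤ) : ZMod m) = 1)
    (γ : SL(2, ℤ)) (h00 : ((γ 0 0 : ℤ) : ZMod m) = ((A - b * B : ℤ) : ZMod m))
    (h01 : ((γ 0 1 : ℤ) : ZMod m) = ((-(c * B) : ℤ) : ZMod m))
    (h10 : ((γ 1 0 : ℤ) : ZMod m) = ((n' * (a * B) : ℤ) : ZMod m))
    (h11 : ((γ 1 1 : ℤ) : ZMod m) = ((n' * A : ℤ) : ZMod m))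
    (y : rayClassField K (Ideal.span {(m : 𝓞 K)})) (hy : e y = f (heegnerTau (a, b, c))) :
    e (artinHom (galFrob K (rayClassField K (Ideal.span {(m : 𝓞 K)})))
        (toPrincipalIdeal (𝓞 K) K (Units.mk0 (β : K) hβ)) y) = f (γ • heegnerTau (a, b, c)) := by
  haveI : IsTotallyComplex K := hK.2
  obtain ⟨x, hx, hβx⟩ := exists_unitIdele_mul_mem_congruenceIdeles (span_natCast_ne_bot hm)
    (Units.mk0 (β : K) hβ) hβm
  rw [← abRestrict_ideleArtinMap_rayClassField_eq_artinHom (span_natCast_ne_bot hm) hx hβx]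
  exact (h K ι hK m hm f hf a b c ha hD hprim θ hθ hgen e he).2 β hβ A B hAB x hx hβx n' hn' γ h00 h01
    h10 h11 y hy

/-! ## The instance `s = η(16τ)³/(η(8τ)η(32τ)²) ∈ 𝖥_{32,ℚ}` -/

/-- `𝕢₃₂(τ)³² = q(τ)`: `(e^{2πiτ/32})³² = e^{2πiτ}`. [folklore] -/
private theorem qParam_thirtyTwo_pow (z : ℂ) :
    Function.Periodic.qParam ((32 : ℕ) : ℝ) z ^ 32 = Function.Periodic.qParam 1 z := by
  rw [Function.Periodic.qParam, Function.Periodic.qParam, ← Complex.exp_nat_mul]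
  congr 1
  push_cast
  ring

/-- **`s = η(16τ)³/(η(8τ)η(32τ)²)` is a holomorphic modular function of level `32` with rational Fourier
coefficients** (`IsRationalModularFunctionOfLevel 32 (etaQuotient 32 rS)`): holomorphic
(`mdifferentiable_etaQuotient_rS`), `Γ(32)`-invariant (`etaQuotient_rS_smul_of_mem_Gamma`, Newman's theorem
with character `(2/·)`), `q·s(γτ)` bounded at `i∞` for every `γ ∈ SL(2,ℤ)`
(`isBoundedAtImInfty_qParam_mul_etaQuotient_rS_comp`), and `𝕢₃₂(τ)³²·s(τ) = q·s(τ) = Σ_k P_k 𝕢₃₂(τ)^{32k}`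
with `P ∈ 1 + qℤ⟦q⟧` (`hasSum_qParam_mul_etaQuotient_rS`, re-indexed along `k ↦ 32k`) — so Cox's Thms.
15.16/15.17 apply to `s` at `m = 32` (this is «`s ∈ F₃₂` with rational q-expansion» of the LEAD's memo §2a–2b).
[cite: Cox2013, §15.A p. 340 (definition of 𝖥_m); Thm. 15.6 p. 342] [cite: Savitt2025, Thm. 1] -/
theorem isRationalModularFunctionOfLevel_etaQuotient_rS :
    IsRationalModularFunctionOfLevel 32 (etaQuotient 32 rS) where
  mdifferentiable := mdifferentiable_etaQuotient_rS
  smul_eq := fun _ hγ τ ↦ etaQuotient_rS_smul_of_mem_Gamma hγ τ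
  isBoundedAtImInfty := fun γ ↦
    ⟨1, by simpa only [pow_one] using isBoundedAtImInfty_qParam_mul_etaQuotient_rS_comp γ⟩
  hasSum_ratCast := by
    obtain ⟨P, _, hP⟩ := exists_int_map_eq_qExpansion_qParam_mul_etaQuotient_rS
    refine ⟨32, fun j ↦ if 32 ∣ j then ((P.coeff (j / 32) : ℤ) : ℚ) else 0, fun τ ↦ ?_⟩
    have h1 := hasSum_qParam_mul_etaQuotient_rS τ
    have hinj : Function.Injective (fun k : ℕ ↦ 32 * k) := mul_right_injective₀ (by norm_num)
    refine (hinj.hasSum_iff ?_).mp ?_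
    · intro j hj
      have hndvd : ¬ 32 ∣ j := fun ⟨k, hk⟩ ↦ hj ⟨k, hk.symm⟩
      simp only [hndvd, if_false, Rat.cast_zero, zero_mul]
    · rw [qParam_thirtyTwo_pow]
      rw [← hP] at h1
      refine h1.congr_fun fun k ↦ ?_
      simp only [Function.comp_apply, Nat.mul_div_cancel_left k (by norm_num : 0 < 32),
        dvd_mul_right, if_true, Rat.cast_intCast, smul_eq_mul, pow_mul, qParam_thirtyTwo_pow,
        PowerSeries.coeff_map, eq_intCast]

/-- **The reciprocity law for `s` at a level-`32` CM point of `𝒪_K`, ideal-theoretically, modulo the fact**: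
for `K` imaginary quadratic embedded by `ι`, `τ₀ = heegnerTau (a, b, c)` with `[1, aτ₀] = ι(𝓞 K)`,
`e : K^{(32)} → ℂ` over `ι`, `β ∈ 𝓞 K` prime to `32` with `ι β = A + B·aτ₀`: `s(τ₀) ∈ e(K^{(32)})` and
`e(((K^{(32)}|K)/(β)) y) = s(γ·τ₀)` for `e y = s(τ₀)`, `γ ≡ (A − bB, −cB; n′aB, n′A) (mod 32)`, `n′N(β) ≡ 1`.
With `32 ∣ a` the lower-left entry of `γ` is `≡ 0 (mod 32)`, so `s(γ·τ₀) = χ₈(d_γ)·s(τ₀) = χ₈(n′A)·s(τ₀)`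
(`etaQuotient_rS_smul`) — the LEAD's «`s(τ)^{σ_u} = (2/d)·s(τ)`» (memo §2b), now by name modulo the print.
[cite: Cox2013, Thms. 15.16–15.17 (p. 347–348)] [cite: Savitt2025, Thm. 1] -/
theorem artinSymbol_etaQuotient_rS_of_fact (h : cox2013_shimuraReciprocity_rayClassField)
    (K : Type) [Field K] [NumberField K] (ι : K →+* ℂ)
    (hK : Literature.NumberTheory.EllipticCurves.IsImaginaryQuadratic K)
    (a b c : ℤ) (ha : 0 < a) (hD : b ^ 2 - 4 * a * c < 0) (hprim : Int.gcd (Int.gcd a b) c = 1)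
    (θ : 𝓞 K) (hθ : ι (θ : K) = (a : ℂ) * ((heegnerTau (a, b, c) : ℍ) : ℂ))
    (hgen : ∀ z : 𝓞 K, ∃ A B : ℤ, (z : K) = A + B * (θ : K))
    (e : rayClassField K (Ideal.span {((32 : ℕ) : 𝓞 K)}) →+* ℂ)
    (he : ∀ k : K, e (algebraMap K (rayClassField K (Ideal.span {((32 : ℕ) : 𝓞 K)})) k) = ι k) :
    etaQuotient 32 rS (heegnerTau (a, b, c)) ∈ Set.range e ∧
    ∀ (β : 𝓞 K) (hβ : (β : K) ≠ 0),
      toPrincipalIdeal (𝓞 K) K (Units.mk0 (β : K) hβ) ∈ idealsPrimeTo (Ideal.span {((32 : ℕ) : 𝓞 K)}) →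
    ∀ (A B : ℤ), (β : K) = A + B * (θ : K) →
    ∀ (n' : ℤ), ((n' * (A ^ 2 - b * A * B + a * c * B ^ 2) : ℤ) : ZMod 32) = 1 →
    ∀ γ : SL(2, ℤ), ((γ 0 0 : ℤ) : ZMod 32) = ((A - b * B : ℤ) : ZMod 32) →
      ((γ 0 1 : ℤ) : ZMod 32) = ((-(c * B) : ℤ) : ZMod 32) →
      ((γ 1 0 : ℤ) : ZMod 32) = ((n' * (a * B) : ℤ) : ZMod 32) →
      ((γ 1 1 : ℤ) : ZMod 32) = ((n' * A : ℤ) : ZMod 32) →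
    ∀ y : rayClassField K (Ideal.span {((32 : ℕ) : 𝓞 K)}), e y = etaQuotient 32 rS (heegnerTau (a, b, c)) →
      e (artinHom (galFrob K (rayClassField K (Ideal.span {((32 : ℕ) : 𝓞 K)})))
          (toPrincipalIdeal (𝓞 K) K (Units.mk0 (β : K) hβ)) y) =
        etaQuotient 32 rS (γ • heegnerTau (a, b, c)) := by
  refine ⟨(h K ι hK 32 (by norm_num) _ isRationalModularFunctionOfLevel_etaQuotient_rS a b c ha hD hprim θ
    hθ hgen e he).1, ?_⟩
  intro β hβ hβm A B hAB n' hn' γ h00 h01 h10 h11 y hy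
  exact artinSymbol_apply_eq_of_fact h K ι hK 32 (by norm_num) _
    isRationalModularFunctionOfLevel_etaQuotient_rS a b c ha hD hprim θ hθ hgen e he β hβ hβm A B hAB n'
    hn' γ h00 h01 h10 h11 y hy

end Literature.NumberTheory.ComplexMultiplication.Cox2013

end
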